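import Summits.BirchSwinnertonDyer.Rank1Residual.Additive.AdditiveTorsionFiveSeven
import Summits.BirchSwinnertonDyer.Rank1Residual.Additive.GordKodairaType
import Summits.BirchSwinnertonDyer.Rank1Residual.Additive.TypeGRamification
import Summits.BirchSwinnertonDyer.Rank1Residual.Additive.PotGoodOrdinary
import HarnessLib

/-!
# `p`-torsion on the additive potentially-good locus READ OFF THE KODAIRA TYPE: only II/III at `5`,
# II at `7`; on the (G)-cell only III@5 (`e = 4`) and II@7 (`e = 6`); `t = 0` on
# X3♯(G-ord)/X4♯(G-ord) everywhere else

HONEST FRAMING (cell `b2b-bsdres`, run/shared/lean/b2b/bsd-rank1-residual/, verbatim in every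
file): the goal of the cell is to DELETE the COMBINATION-SHAPED residual classes of the
Birch–Swinnerton-Dyer formula for ALL analytic-rank `≤ 1` elliptic curves over `ℚ` — "full BSD
formula for every rank `≤ 1` curve in class `C`" assembled STRICTLY from published theorems — so
that the rank-`≤ 1` remainder becomes exactly the CONSTRUCTION-SHAPED classes, which are TYPED
(missing-input `Prop`s), NOT attempted. This is not "finishing BSD". Sub-cell `additive-p2`
(X3♯(G-ord) / X4♯(G-ord)), generation 37: research route; no claim beyond the stated classes;
theorems only, no definition, no named fact, nothing booked, no label moved.

## What and why

`Additive/AdditiveTorsionFiveSeven` located the `p`-torsion of `E(ℚ_p)` at an additive `p ≥ 5` on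
`(p = 5 ∧ v₅(c₄) = 1) ∨ (p = 7 ∧ v₇(c₆) = 1)`.  Here the locus is read in the cell's dictionary
(gen 14's `kodairaSymbolAt_placeOf_cases_of_addv`: at an additive `p ≥ 5` the Kodaira type is
`ord_p Δ_min` — II↦2, III↦3, IV↦4, Iₙ*↦n+6, IV*↦8, III*↦9, II*↦10; gen 2's
`typeG_iff_not_subM_and_semistabilityIndex_dvd`: (G) ⟺ `e ∣ p − 1` off (M)):

* `padicValInt_minimalDiscriminantInt_eq_two_of_padicValRat_c₆_eq_one`,
  `padicValInt_minimalDiscriminantInt_of_padicValRat_c₄_eq_one` — `1728Δ = c₄³ − c₆²` with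
  `p ∣ c₄, c₆` at an additive `p`: `v(c₆) = 1 ⟹ v(Δ_min) = 2`; `v(c₄) = 1 ⟹ v(Δ_min) ∈ {2, 3}`;
* **`padicValInt_minimalDiscriminantInt_of_prime_zsmul_eq_zero_of_addv`** /
  **`kodairaSymbolAt_of_prime_zsmul_eq_zero_of_addv`**: `P ≠ O`, `p • P = O` in `E(ℚ_p)` at an
  additive `p ≥ 5` ⟹ `(p = 5 ∧ type ∈ {II, III}) ∨ (p = 7 ∧ type = II)`; hence
  **`eq_zero_of_prime_nsmul_eq_zero_of_addv_of_four_le`**: `E(ℚ_p)[p] = 0` at EVERY additive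
  `p ≥ 5` of type IV, Iₙ*, IV*, III*, II* (`4 ≤ v_p(Δ_min)`), and
  `padicValNat_torsionOrder_eq_zero_of_addv_of_four_le` (`t = 0` there);
* the (G)-CELL: **`TypeG.padicValInt_of_prime_zsmul_eq_zero`** — (G) at `p` and `p`-torsion in
  `E(ℚ_p)` ⟹ `(p = 5 ∧ v₅(Δ_min) = 3)` (III, `e = 4`) `∨ (p = 7 ∧ v₇(Δ_min) = 2)` (II, `e = 6`)
  (at `5`, type II has `e = 6 ∤ 4`); `TypeG.eq_zero_of_prime_nsmul_eq_zero`,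
  `TypeG.padicValNat_torsionOrder_eq_zero` (`t = 0` on the (G)-cell off III@5 / II@7; in
  particular on ALL of defect `2` (I₀*) and defect `3` (IV, IV*), on every starred type, and at
  every `p ≥ 11`);
* CLASS LEVEL: **`ClassX3Gord.padicValNat_torsionOrder_eq_zero`**,
  `ClassX4Gord.padicValNat_torsionOrder_eq_zero`, `ClassX3Gord.eq_zero_of_prime_nsmul_eq_zero`,
  `ClassX4Gord.…` — the `2·ord_p #E(ℚ)_tors` term of the squeeze / full-squeeze / analytic-Ш laws
  (gens 29–33) and of Delbourgo 2002 (B) clause 3 VANISHES on X3♯(G-ord)/X4♯(G-ord) away from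
  {III@5, II@7}; on X4 this was automatic (irreducible `E[p]`), on X3 it is new.

Sharpness: `[−19, −100, −100, 0, 0]` (`X₁(7)`, `d = 5`; conductor `490`; type II at `7`, `e = 6`)
is a (G)-ordinary pair at `7` with a rational point of order `7`.

References: [Mazur1977] Ch. III §5, Step 1; [SilvermanATAEC1994] IV Table 4.1;
[SilvermanAEC2009] VII.3; D. Delbourgo, Compositio Math. 113 (1998) §1.5 (G).
-/

noncomputable section

open scoped Classical NumberField

open WeierstrassCurve IsDedekindDomain IsDedekindDomain.HeightOneSpectrum NumberField
  Rat.HeightOneSpectrum Literature.NumberTheory.EllipticCurves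
  Literature.NumberTheory.EllipticCurves.Rank1Residual
  Literature.NumberTheory.DiophantineGeometry

namespace Summit.BirchSwinnertonDyer.Rank1Residual.Additive

variable (W : WeierstrassCurve ℚ) [W.IsElliptic] [W.IsGloballyMinimal] (p : ℕ) [hp : Fact p.Prime]

/-! ## §1 `v(Δ_min)` from `v(c₄) = 1` / `v(c₆) = 1` at an additive `p ≥ 5` -/

omit [W.IsElliptic] [W.IsGloballyMinimal] in
/-- `v_p(1728) = 0` for `p ≥ 5` (`1728 = 2⁶·3³`). [folklore] -/
theorem padicValRat_1728_eq_zero' (hp5 : 5 ≤ p) : padicValRat p (1728 : ℚ) = 0 := by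
  have h : padicValNat p 1728 = 0 := by
    refine padicValNat.eq_zero_of_not_dvd fun hd => ?_
    have h' : p ∣ 2 ^ 6 * 3 ^ 3 := by norm_num at hd ⊢; exact hd
    rcases (Nat.Prime.dvd_mul hp.out).mp h' with h2 | h3
    · have := Nat.le_of_dvd (by norm_num) (hp.out.dvd_of_dvd_pow h2); omega
    · have := Nat.le_of_dvd (by norm_num) (hp.out.dvd_of_dvd_pow h3); omega
  have : padicValRat p ((1728 : ℕ) : ℚ) = 0 := by rw [padicValRat.of_nat, h]; simp
  exact_mod_cast this

/-- `v_p(1728·Δ) = v_p(Δ_min)` for the globally minimal model (`p ≥ 5`). [folklore] -/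
theorem padicValRat_1728_mul_Δ (hp5 : 5 ≤ p) :
    padicValRat p (1728 * W.Δ) = padicValInt p W.minimalDiscriminantInt := by
  have hΔ0 : W.Δ ≠ 0 := W.isUnit_Δ.ne_zero
  rw [padicValRat.mul (by norm_num) hΔ0, padicValRat_1728_eq_zero' p hp5, zero_add,
    padicValRat_Δ_eq W p]

/-- **`v_p(c₆) = 1` at an additive `p ≥ 5` ⟹ `v_p(Δ_min) = 2`** (Kodaira II):
`1728Δ = c₄³ − c₆²` with `v(c₄³) ≥ 3 > 2 = v(c₆²)` (or `c₄ = 0`). [cite: SilvermanATAEC1994, IV Table 4.1 (PDF p. 365)] -/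
theorem padicValInt_minimalDiscriminantInt_eq_two_of_padicValRat_c₆_eq_one (hp5 : 5 ≤ p)
    (hadd : Addv W p) (h6 : padicValRat p W.c₆ = 1) :
    padicValInt p W.minimalDiscriminantInt = 2 := by
  have hΔ0 : W.Δ ≠ 0 := W.isUnit_Δ.ne_zero
  have h1728 : (1728 : ℚ) * W.Δ ≠ 0 := mul_ne_zero (by norm_num) hΔ0
  have hc6 : W.c₆ ≠ 0 := by
    intro h0; rw [h0, padicValRat.zero] at h6; exact zero_ne_one h6
  have hrel : 1728 * W.Δ = W.c₄ ^ 3 + -(W.c₆ ^ 2) := by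
    have := W.c_relation; linear_combination this
  have hv6 : padicValRat p (-(W.c₆ ^ 2)) = 2 := by
    rw [padicValRat.neg, padicValRat.pow, h6]; norm_num
  suffices h : padicValRat p (1728 * W.Δ) = 2 by
    have := padicValRat_1728_mul_Δ W p hp5; rw [h] at this; exact_mod_cast this.symm
  rw [hrel]
  rcases (padicValRat_c₄_c₆_of_addv W p hadd).1 with h0 | h4
  · rw [h0, zero_pow three_ne_zero, zero_add, hv6]
  · have hc4 : W.c₄ ≠ 0 := by
      intro h0; rw [h0, padicValRat.zero] at h4; exact absurd h4 (by norm_num)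
    have hv4 : padicValRat p (W.c₄ ^ 3) = 3 * padicValRat p W.c₄ := by
      rw [padicValRat.pow]; push_cast; ring
    have hne : padicValRat p (W.c₄ ^ 3) ≠ padicValRat p (-(W.c₆ ^ 2)) := by
      rw [hv4, hv6]; omega
    rw [padicValRat.add_eq_min (hrel ▸ h1728) (pow_ne_zero 3 hc4) (neg_ne_zero.mpr
      (pow_ne_zero 2 hc6)) hne, hv4, hv6]
    exact min_eq_right (by omega)

/-- **`v_p(c₄) = 1` at an additive `p ≥ 5` ⟹ `v_p(Δ_min) ∈ {2, 3}`** (Kodaira II or III):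
`v(c₄³) = 3`, `v(c₆²)` even. [cite: SilvermanATAEC1994, IV Table 4.1 (PDF p. 365)] -/
theorem padicValInt_minimalDiscriminantInt_of_padicValRat_c₄_eq_one (hp5 : 5 ≤ p)
    (hadd : Addv W p) (h4 : padicValRat p W.c₄ = 1) :
    padicValInt p W.minimalDiscriminantInt = 2 ∨ padicValInt p W.minimalDiscriminantInt = 3 := by
  have hΔ0 : W.Δ ≠ 0 := W.isUnit_Δ.ne_zero
  have h1728 : (1728 : ℚ) * W.Δ ≠ 0 := mul_ne_zero (by norm_num) hΔ0
  have hc4 : W.c₄ ≠ 0 := by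
    intro h0; rw [h0, padicValRat.zero] at h4; exact zero_ne_one h4
  have hrel : 1728 * W.Δ = W.c₄ ^ 3 + -(W.c₆ ^ 2) := by
    have := W.c_relation; linear_combination this
  have hv4 : padicValRat p (W.c₄ ^ 3) = 3 := by rw [padicValRat.pow, h4]; norm_num
  have key : padicValRat p (1728 * W.Δ) = 2 ∨ padicValRat p (1728 * W.Δ) = 3 := by
    rw [hrel]
    rcases (padicValRat_c₄_c₆_of_addv W p hadd).2 with h0 | h6
    · right; rw [h0, zero_pow two_ne_zero, neg_zero, add_zero, hv4]
    · have hc6 : W.c₆ ≠ 0 := by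
        intro h0; rw [h0, padicValRat.zero] at h6; exact absurd h6 (by norm_num)
      have hv6 : padicValRat p (-(W.c₆ ^ 2)) = 2 * padicValRat p W.c₆ := by
        rw [padicValRat.neg, padicValRat.pow]; push_cast; ring
      have hne : padicValRat p (W.c₄ ^ 3) ≠ padicValRat p (-(W.c₆ ^ 2)) := by
        rw [hv4, hv6]; omega
      rw [padicValRat.add_eq_min (hrel ▸ h1728) (pow_ne_zero 3 hc4) (neg_ne_zero.mpr
        (pow_ne_zero 2 hc6)) hne, hv4, hv6]
      rcases (show padicValRat p W.c₆ = 1 ∨ 2 ≤ padicValRat p W.c₆ by omega) with h | h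
      · left; rw [h]; norm_num
      · right; exact min_eq_left (by omega)
  have e := padicValRat_1728_mul_Δ W p hp5
  rcases key with h | h <;> rw [h] at e
  · left; exact_mod_cast e.symm
  · right; exact_mod_cast e.symm

/-! ## §2 `p`-torsion in `E(ℚ_p)` at an additive `p ≥ 5`, read off the Kodaira type -/

/-- **`p`-torsion ⟹ `(p = 5 ∧ v₅(Δ_min) ∈ {2, 3}) ∨ (p = 7 ∧ v₇(Δ_min) = 2)`** for `P ≠ O`,
`p • P = O` in `E(ℚ_p)` at an additive `p ≥ 5`. [cite: Mazur1977, Ch. III §5, Step 1, p. 158] -/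
theorem padicValInt_minimalDiscriminantInt_of_prime_zsmul_eq_zero_of_addv (hp5 : 5 ≤ p)
    (hadd : Addv W p) {P : (W.baseChange ℚ_[p]).toAffine.Point} (hP0 : P ≠ 0)
    (hP : (p : ℤ) • P = 0) :
    (p = 5 ∧ (padicValInt p W.minimalDiscriminantInt = 2 ∨
        padicValInt p W.minimalDiscriminantInt = 3)) ∨
      (p = 7 ∧ padicValInt p W.minimalDiscriminantInt = 2) := by
  rcases padicValRat_c₄_or_c₆_of_prime_zsmul_eq_zero_of_addv W p hp5 hadd hP0 hP with
    ⟨h, hv⟩ | ⟨h, hv⟩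
  · exact Or.inl ⟨h, padicValInt_minimalDiscriminantInt_of_padicValRat_c₄_eq_one W p hp5 hadd hv⟩
  · exact Or.inr ⟨h,
      padicValInt_minimalDiscriminantInt_eq_two_of_padicValRat_c₆_eq_one W p hp5 hadd hv⟩

/-- **The Kodaira reading**: `p`-torsion in `E(ℚ_p)` at an additive `p ≥ 5` ⟹
`(p = 5 ∧ type ∈ {II, III}) ∨ (p = 7 ∧ type = II)`. Never on a starred type, never on `Iₙ*`,
never on IV, never at `p ≥ 11`. [cite: Mazur1977, Ch. III §5, Step 1, p. 158] -/
theorem kodairaSymbolAt_of_prime_zsmul_eq_zero_of_addv (hp5 : 5 ≤ p) (hadd : Addv W p)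
    {P : (W.baseChange ℚ_[p]).toAffine.Point} (hP0 : P ≠ 0) (hP : (p : ℤ) • P = 0) :
    (p = 5 ∧ (W.kodairaSymbolAt (placeOf p) = .II ∨ W.kodairaSymbolAt (placeOf p) = .III)) ∨
      (p = 7 ∧ W.kodairaSymbolAt (placeOf p) = .II) := by
  rcases padicValInt_minimalDiscriminantInt_of_prime_zsmul_eq_zero_of_addv W p hp5 hadd hP0 hP
    with ⟨h, hv | hv⟩ | ⟨h, hv⟩
  · exact Or.inl ⟨h, Or.inl ((kodairaSymbolAt_placeOf_eq_II_iff_of_addv W p hp5 hadd).mpr hv)⟩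
  · exact Or.inl ⟨h, Or.inr ((kodairaSymbolAt_placeOf_eq_III_iff_of_addv W p hp5 hadd).mpr hv)⟩
  · exact Or.inr ⟨h, (kodairaSymbolAt_placeOf_eq_II_iff_of_addv W p hp5 hadd).mpr hv⟩

/-- **`E(ℚ_p)[p] = 0` at every additive `p ≥ 5` with `4 ≤ v_p(Δ_min)`** (types IV, Iₙ*, IV*,
III*, II* — in particular every starred type and the whole potentially multiplicative additive
locus). [cite: Mazur1977, Ch. III §5, Step 1, p. 158] -/
theorem eq_zero_of_prime_nsmul_eq_zero_of_addv_of_four_le (hp5 : 5 ≤ p) (hadd : Addv W p)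
    (hv : 4 ≤ padicValInt p W.minimalDiscriminantInt)
    {P : (W.baseChange ℚ_[p]).toAffine.Point} (hP : p • P = 0) : P = 0 := by
  by_contra hP0
  rcases padicValInt_minimalDiscriminantInt_of_prime_zsmul_eq_zero_of_addv W p hp5 hadd hP0
    (by rw [natCast_zsmul]; exact hP) with ⟨-, hv' | hv'⟩ | ⟨-, hv'⟩ <;> omega

/-- `t = ord_p #E(ℚ)_tors = 0` at every additive `p ≥ 5` with `4 ≤ v_p(Δ_min)`.
[cite: Mazur1977, Ch. III §5, Step 1, p. 158] -/
theorem padicValNat_torsionOrder_eq_zero_of_addv_of_four_le (hp5 : 5 ≤ p) (hadd : Addv W p)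
    (hv : 4 ≤ padicValInt p W.minimalDiscriminantInt) : padicValNat p W.torsionOrder = 0 :=
  padicValNat.eq_zero_of_not_dvd (not_dvd_torsionOrder_of_noPTorsion W p
    (fun _ hQ => eq_zero_of_prime_nsmul_eq_zero_of_addv_of_four_le W p hp5 hadd hv hQ))

/-! ## §3 The (G)-cell: only III@5 and II@7 -/

variable {W p}

/-- **(G) and `p`-torsion in `E(ℚ_p)` ⟹ `(p = 5 ∧ v₅(Δ_min) = 3)` (III, `e = 4`) `∨
(p = 7 ∧ v₇(Δ_min) = 2)` (II, `e = 6`)**: at `5` the defect divides `p − 1 = 4`, which excludes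
type II (`e = 6`). [cite: Mazur1977, Ch. III §5, Step 1, p. 158; Delbourgo1998, §1.5] -/
theorem TypeG.padicValInt_of_prime_zsmul_eq_zero (hG : TypeG W p) (hp5 : 5 ≤ p) (hadd : Addv W p)
    {P : (W.baseChange ℚ_[p]).toAffine.Point} (hP0 : P ≠ 0) (hP : (p : ℤ) • P = 0) :
    (p = 5 ∧ padicValInt p W.minimalDiscriminantInt = 3) ∨
      (p = 7 ∧ padicValInt p W.minimalDiscriminantInt = 2) := by
  rcases padicValInt_minimalDiscriminantInt_of_prime_zsmul_eq_zero_of_addv W p hp5 hadd hP0 hP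
    with ⟨h, hv | hv⟩ | ⟨h, hv⟩
  · exfalso
    have he := ((typeG_iff_not_subM_and_semistabilityIndex_dvd W p hp5).mp hG).2
    unfold semistabilityIndex at he
    rw [hv, h] at he
    exact absurd he (by decide)
  · exact Or.inl ⟨h, hv⟩
  · exact Or.inr ⟨h, hv⟩

/-- The same in Kodaira symbols: (G) and `p`-torsion ⟹ `(p = 5 ∧ III) ∨ (p = 7 ∧ II)`.
[cite: Mazur1977, Ch. III §5, Step 1, p. 158; Delbourgo1998, §1.5] -/
theorem TypeG.kodairaSymbolAt_of_prime_zsmul_eq_zero (hG : TypeG W p) (hp5 : 5 ≤ p)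
    (hadd : Addv W p) {P : (W.baseChange ℚ_[p]).toAffine.Point} (hP0 : P ≠ 0)
    (hP : (p : ℤ) • P = 0) :
    (p = 5 ∧ W.kodairaSymbolAt (placeOf p) = .III) ∨ (p = 7 ∧ W.kodairaSymbolAt (placeOf p) = .II) := by
  rcases hG.padicValInt_of_prime_zsmul_eq_zero hp5 hadd hP0 hP with ⟨h, hv⟩ | ⟨h, hv⟩
  · exact Or.inl ⟨h, (kodairaSymbolAt_placeOf_eq_III_iff_of_addv W p hp5 hadd).mpr hv⟩
  · exact Or.inr ⟨h, (kodairaSymbolAt_placeOf_eq_II_iff_of_addv W p hp5 hadd).mpr hv⟩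

/-- The same in defects: (G) and `p`-torsion ⟹ `(p = 5 ∧ e = 4) ∨ (p = 7 ∧ e = 6)`.
[cite: Mazur1977, Ch. III §5, Step 1, p. 158; Delbourgo1998, §1.5] -/
theorem TypeG.semistabilityIndex_of_prime_zsmul_eq_zero (hG : TypeG W p) (hp5 : 5 ≤ p)
    (hadd : Addv W p) {P : (W.baseChange ℚ_[p]).toAffine.Point} (hP0 : P ≠ 0)
    (hP : (p : ℤ) • P = 0) :
    (p = 5 ∧ semistabilityIndex W p = 4) ∨ (p = 7 ∧ semistabilityIndex W p = 6) := by
  rcases hG.padicValInt_of_prime_zsmul_eq_zero hp5 hadd hP0 hP with ⟨h, hv⟩ | ⟨h, hv⟩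
  · left; refine ⟨h, ?_⟩; unfold semistabilityIndex; rw [hv]; decide
  · right; refine ⟨h, ?_⟩; unfold semistabilityIndex; rw [hv]; decide

/-- **`E(ℚ_p)[p] = 0` on the (G)-cell off III@5 / II@7.** In particular on the whole defect-`2`
(`I₀*`) and defect-`3` (IV, IV*) parts, on every starred type, and at every `p ≥ 11`.
[cite: Mazur1977, Ch. III §5, Step 1, p. 158; Delbourgo1998, §1.5] -/
theorem TypeG.eq_zero_of_prime_nsmul_eq_zero (hG : TypeG W p) (hp5 : 5 ≤ p) (hadd : Addv W p)
    (h5 : p = 5 → padicValInt p W.minimalDiscriminantInt ≠ 3)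
    (h7 : p = 7 → padicValInt p W.minimalDiscriminantInt ≠ 2)
    {P : (W.baseChange ℚ_[p]).toAffine.Point} (hP : p • P = 0) : P = 0 := by
  by_contra hP0
  rcases hG.padicValInt_of_prime_zsmul_eq_zero hp5 hadd hP0 (by rw [natCast_zsmul]; exact hP)
    with ⟨h, hv⟩ | ⟨h, hv⟩
  · exact h5 h hv
  · exact h7 h hv

/-- **`t = ord_p #E(ℚ)_tors = 0` on the (G)-cell off III@5 / II@7.**
[cite: Mazur1977, Ch. III §5, Step 1, p. 158; Delbourgo1998, §1.5] -/
theorem TypeG.padicValNat_torsionOrder_eq_zero (hG : TypeG W p) (hp5 : 5 ≤ p) (hadd : Addv W p)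
    (h5 : p = 5 → padicValInt p W.minimalDiscriminantInt ≠ 3)
    (h7 : p = 7 → padicValInt p W.minimalDiscriminantInt ≠ 2) :
    padicValNat p W.torsionOrder = 0 :=
  padicValNat.eq_zero_of_not_dvd (not_dvd_torsionOrder_of_noPTorsion W p
    (fun _ hQ => hG.eq_zero_of_prime_nsmul_eq_zero hp5 hadd h5 h7 hQ))

/-- Defect `2` (Kodaira `I₀*`, `v_p(Δ_min) = 6`): **`t = 0` on the whole defect-2 part of the
(G)-cell, every `p ≥ 5`.** [cite: Mazur1977, Ch. III §5, Step 1, p. 158] -/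
theorem TypeG.padicValNat_torsionOrder_eq_zero_of_semistabilityIndex_eq_two (hG : TypeG W p)
    (hp5 : 5 ≤ p) (hadd : Addv W p) (he : semistabilityIndex W p = 2) :
    padicValNat p W.torsionOrder = 0 := by
  refine hG.padicValNat_torsionOrder_eq_zero hp5 hadd (fun _ hv => ?_) (fun _ hv => ?_) <;>
    · unfold semistabilityIndex at he; rw [hv] at he; exact absurd he (by decide)

/-- Defect `3` (Kodaira IV / IV*, `v_p(Δ_min) ∈ {4, 8}`): **`t = 0` on the whole defect-3 part of
the (G)-cell, every `p ≥ 5`.** [cite: Mazur1977, Ch. III §5, Step 1, p. 158] -/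
theorem TypeG.padicValNat_torsionOrder_eq_zero_of_semistabilityIndex_eq_three (hG : TypeG W p)
    (hp5 : 5 ≤ p) (hadd : Addv W p) (he : semistabilityIndex W p = 3) :
    padicValNat p W.torsionOrder = 0 := by
  refine hG.padicValNat_torsionOrder_eq_zero hp5 hadd (fun _ hv => ?_) (fun _ hv => ?_) <;>
    · unfold semistabilityIndex at he; rw [hv] at he; exact absurd he (by decide)

/-- Starred types (`6 ≤ v_p(Δ_min)`: I₀*, IV*, III*, II*): **`t = 0`**, every additive `p ≥ 5`
(no (G) needed). [cite: Mazur1977, Ch. III §5, Step 1, p. 158] -/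
theorem padicValNat_torsionOrder_eq_zero_of_addv_of_six_le (hp5 : 5 ≤ p) (hadd : Addv W p)
    (hv : 6 ≤ padicValInt p W.minimalDiscriminantInt) : padicValNat p W.torsionOrder = 0 :=
  padicValNat_torsionOrder_eq_zero_of_addv_of_four_le W p hp5 hadd (by omega)

/-! ## §4 Class level: X3♯(G-ord), X4♯(G-ord) -/

/-- **X3♯(G-ord): `t = ord_p #E(ℚ)_tors = 0` off III@5 / II@7** (`p ≥ 5`) — the torsion term of
every leading-term identity of the sub-cell vanishes on the reducible half too.
[cite: Mazur1977, Ch. III §5, Step 1, p. 158; Delbourgo1998, §1.5] -/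
theorem ClassX3Gord.padicValNat_torsionOrder_eq_zero (hX : ClassX3Gord W p) (hp5 : 5 ≤ p)
    (h5 : p = 5 → padicValInt p W.minimalDiscriminantInt ≠ 3)
    (h7 : p = 7 → padicValInt p W.minimalDiscriminantInt ≠ 2) :
    padicValNat p W.torsionOrder = 0 :=
  hX.2.typeG.padicValNat_torsionOrder_eq_zero hp5 hX.1.2 h5 h7

/-- **X3♯(G-ord): `E(ℚ_p)[p] = 0` off III@5 / II@7** (`p ≥ 5`).
[cite: Mazur1977, Ch. III §5, Step 1, p. 158; Delbourgo1998, §1.5] -/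
theorem ClassX3Gord.eq_zero_of_prime_nsmul_eq_zero (hX : ClassX3Gord W p) (hp5 : 5 ≤ p)
    (h5 : p = 5 → padicValInt p W.minimalDiscriminantInt ≠ 3)
    (h7 : p = 7 → padicValInt p W.minimalDiscriminantInt ≠ 2)
    {P : (W.baseChange ℚ_[p]).toAffine.Point} (hP : p • P = 0) : P = 0 :=
  hX.2.typeG.eq_zero_of_prime_nsmul_eq_zero hp5 hX.1.2 h5 h7 hP

/-- **X4♯(G-ord): `t = 0` off III@5 / II@7** (`p ≥ 5`; on X4 the rational statement is also a
consequence of irreducibility — here it comes with the LOCAL statement `E(ℚ_p)[p] = 0`, which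
irreducibility does not give). [cite: Mazur1977, Ch. III §5, Step 1, p. 158; Delbourgo1998, §1.5] -/
theorem ClassX4Gord.padicValNat_torsionOrder_eq_zero (hX : ClassX4Gord W p) (hp5 : 5 ≤ p)
    (h5 : p = 5 → padicValInt p W.minimalDiscriminantInt ≠ 3)
    (h7 : p = 7 → padicValInt p W.minimalDiscriminantInt ≠ 2) :
    padicValNat p W.torsionOrder = 0 :=
  hX.2.typeG.padicValNat_torsionOrder_eq_zero hp5 hX.1.2.1 h5 h7

/-- **X4♯(G-ord): `E(ℚ_p)[p] = 0` off III@5 / II@7** (`p ≥ 5`).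
[cite: Mazur1977, Ch. III §5, Step 1, p. 158; Delbourgo1998, §1.5] -/
theorem ClassX4Gord.eq_zero_of_prime_nsmul_eq_zero (hX : ClassX4Gord W p) (hp5 : 5 ≤ p)
    (h5 : p = 5 → padicValInt p W.minimalDiscriminantInt ≠ 3)
    (h7 : p = 7 → padicValInt p W.minimalDiscriminantInt ≠ 2)
    {P : (W.baseChange ℚ_[p]).toAffine.Point} (hP : p • P = 0) : P = 0 :=
  hX.2.typeG.eq_zero_of_prime_nsmul_eq_zero hp5 hX.1.2.1 h5 h7 hP

/-- **X3♯(G-ord) ∪ X4♯(G-ord) on defect `2` (the `I₀*` cell, 681 window pairs): `t = 0` at every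
`p ≥ 5`, no side condition.** [cite: Mazur1977, Ch. III §5, Step 1, p. 158; Delbourgo1998, §1.5] -/
theorem ClassX3Gord.padicValNat_torsionOrder_eq_zero_of_semistabilityIndex_eq_two
    (hX : ClassX3Gord W p) (hp5 : 5 ≤ p) (he : semistabilityIndex W p = 2) :
    padicValNat p W.torsionOrder = 0 :=
  hX.2.typeG.padicValNat_torsionOrder_eq_zero_of_semistabilityIndex_eq_two hp5 hX.1.2 he

end Summit.BirchSwinnertonDyer.Rank1Residual.Additive

end
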